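import Mathlib

/-!
# LINE L13 «DBR POLYNOMIAL DOOR» — node 4: the local sign `Im (p · conj p′) < 0` just below an upper root

Cell rh-split, route `DeBrangesSuzukiDoor`, item `stmt-RiemannHypothesis-21499` (`PolyDoorLocalSign`, registrar
rh-split-dbr-neg g16, skeleton `LineDbrB0.lean`).  Let `p ≠ 0` be a real polynomial, `p_ℂ = p.map (algebraMap ℝ ℂ)`,
and `a` a root of `p_ℂ` with `Im a > 0`, of multiplicity `m = k + 1 ≥ 1`: `p_ℂ = (X − a)^{k+1}·r`, `r(a) ≠ 0`.
Along the vertical segment `z = a − i t` (`0 < t < Im a`) one has `z − a = −it`,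
`p_ℂ(z) = (−it)^{k+1} r(z)`, `p_ℂ′(z) = (−it)^k ((k+1) r(z) − it·r′(z))`, hence
`p_ℂ(z)·conj p_ℂ′(z) = |t|^{2k} · (−it)·r(z)·conj((k+1) r(z) − it r′(z))` and
`Im (p_ℂ(z)·conj p_ℂ′(z)) = −t^{2k+1}·[(k+1)|r(z)|² − t·Im(r(z) conj r′(z))]`,
which is `< 0` for small `t > 0` by continuity (`(k+1)|r(a)|² > 0`).

Proved BY VALUE (the item's `payload.signature` verbatim; the route file does not yet declare the decl).
Classical (Hermite–Biehler mechanism, Levin 1964 ch. VII); E-GENERAL, RH-free, Mathlib only.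
HONEST LABEL: known mathematics, RECORD line, 0 summit credit; nothing here bears on the truth of RH.
-/

set_option linter.dupNamespace false

namespace Summit.RiemannHypothesis.RiemannHypothesis.Theorems.Splittings.PolyDoorLocalSign

open Polynomial Filter Topology
open scoped ComplexConjugate

/-- Algebra: `(w^{k+1} u)·conj(w^k (c u + w v)) = |w^k|² · (w u · conj (c u + w v))`. [folklore] -/
theorem mul_conj_factor (w u v c : ℂ) (k : ℕ) :
    (w ^ (k + 1) * u) * conj (w ^ k * (c * u + w * v)) =
      ((Complex.normSq (w ^ k) : ℝ) : ℂ) * (w * u * conj (c * u + w * v)) := by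
  rw [← Complex.mul_conj]
  simp only [map_mul]
  ring

/-- The imaginary part along the downward vertical direction `w = −it`:
`Im((−it)·u·conj((k+1)u − it v)) = −t·((k+1)|u|² − t·Im(u conj v))`. [folklore] -/
theorem im_vertical (u v : ℂ) (t : ℝ) (k : ℕ) :
    ((-(Complex.I * t)) * u * conj (((k : ℂ) + 1) * u + (-(Complex.I * t)) * v)).im =
      -t * (((k : ℝ) + 1) * Complex.normSq u - t * (u * conj v).im) := by
  simp only [Complex.mul_im, Complex.mul_re, Complex.neg_re, Complex.neg_im, Complex.I_re,
    Complex.I_im, Complex.ofReal_re, Complex.ofReal_im, map_add, map_mul, map_neg, map_one,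
    map_natCast, Complex.conj_I, Complex.conj_ofReal, Complex.add_re, Complex.add_im, Complex.conj_re,
    Complex.conj_im, Complex.normSq_apply, Complex.natCast_re, Complex.natCast_im, Complex.one_re,
    Complex.one_im]
  ring

/-- Evaluation of the factored polynomial: `((X − a)^{k+1} r)(z) = (z − a)^{k+1} r(z)`. [folklore] -/
theorem eval_factor (a : ℂ) (r : ℂ[X]) (k : ℕ) (z : ℂ) :
    ((X - C a) ^ (k + 1) * r).eval z = (z - a) ^ (k + 1) * r.eval z := by
  simp only [eval_mul, eval_pow, eval_sub, eval_X, eval_C]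

/-- Evaluation of the derivative of the factored polynomial:
`((X − a)^{k+1} r)′(z) = (z − a)^k ((k+1) r(z) + (z − a) r′(z))`. [folklore] -/
theorem eval_derivative_factor (a : ℂ) (r : ℂ[X]) (k : ℕ) (z : ℂ) :
    (derivative ((X - C a) ^ (k + 1) * r)).eval z =
      (z - a) ^ k * (((k : ℂ) + 1) * r.eval z + (z - a) * (derivative r).eval z) := by
  simp only [derivative_mul, derivative_pow_succ, derivative_sub, derivative_X, derivative_C, sub_zero,
    mul_one, eval_add, eval_mul, eval_pow, eval_C, eval_sub, eval_X]
  ring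

/-- The analytic core over `ℂ`: if `Im a > 0` and `r(a) ≠ 0` then for `P = (X − a)^{k+1} r` some point
`z = a − it` of the open upper half-plane has `Im (P(z) conj P′(z)) < 0`. [folklore] -/
theorem exists_im_mul_conj_derivative_neg (r : ℂ[X]) {a : ℂ} (ha : 0 < a.im) (hra : r.eval a ≠ 0)
    (k : ℕ) :
    ∃ z : ℂ, 0 < z.im ∧ (((X - C a) ^ (k + 1) * r).eval z *
      conj ((derivative ((X - C a) ^ (k + 1) * r)).eval z)).im < 0 := by
  -- the bracket `(k+1)|r(z)|² − t·Im(r(z) conj r′(z))` along `z = a − it`, as a function of `t`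
  set g : ℝ → ℝ := fun t => ((k : ℝ) + 1) * Complex.normSq (r.eval (a - Complex.I * t)) -
    t * (r.eval (a - Complex.I * t) * conj ((derivative r).eval (a - Complex.I * t))).im with hg_def
  have hg : Continuous g := by
    rw [hg_def]
    fun_prop
  have hg0 : 0 < g 0 := by
    simp only [hg_def, Complex.ofReal_zero, mul_zero, sub_zero, zero_mul]
    exact mul_pos (by positivity) (Complex.normSq_pos.2 hra)
  have h1 : ∀ᶠ t in 𝓝 (0 : ℝ), 0 < g t := (hg.tendsto 0).eventually_const_lt hg0
  have h2 : ∀ᶠ t in 𝓝 (0 : ℝ), t < a.im := Iio_mem_nhds ha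
  have h3 : ∀ᶠ t in 𝓝[>] (0 : ℝ), 0 < t := self_mem_nhdsWithin
  obtain ⟨t, hgt, hta, ht0⟩ := ((h1.filter_mono nhdsWithin_le_nhds).and
    ((h2.filter_mono nhdsWithin_le_nhds).and h3)).exists
  refine ⟨a - Complex.I * t, ?_, ?_⟩
  · simp only [Complex.sub_im, Complex.mul_im, Complex.I_re, Complex.ofReal_im, mul_zero,
      Complex.I_im, Complex.ofReal_re, one_mul, zero_add]
    linarith
  · rw [eval_factor, eval_derivative_factor]
    have hw : a - Complex.I * t - a = -(Complex.I * t) := by ring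
    rw [hw, mul_conj_factor, Complex.im_ofReal_mul, im_vertical]
    have hpos : 0 < Complex.normSq ((-(Complex.I * t)) ^ k) :=
      Complex.normSq_pos.2 (pow_ne_zero _ (neg_ne_zero.2
        (mul_ne_zero Complex.I_ne_zero (Complex.ofReal_ne_zero.2 ht0.ne'))))
    have hneg : -t * (((k : ℝ) + 1) * Complex.normSq (r.eval (a - Complex.I * t)) -
        t * (r.eval (a - Complex.I * t) * conj ((derivative r).eval (a - Complex.I * t))).im) < 0 := by
      have hgt' : 0 < g t := hgt
      simp only [hg_def] at hgt'
      nlinarith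
    exact mul_neg_of_pos_of_neg hpos hneg

/-- **Node 4 of LINE L13 (item `stmt-RiemannHypothesis-21499`, `PolyDoorLocalSign` by value).**
If `a ∈ ℂ₊` is a root of `p_ℂ` (`p ≠ 0` real) then some `z ∈ ℂ₊` (just below `a`) has
`Im (p_ℂ(z) · conj (p_ℂ′(z))) < 0`. [folklore] (Hermite–Biehler mechanism; Levin, *Distribution of zeros of
entire functions*, ch. VII.) -/
theorem polyDoorLocalSign :
    ∀ p : Polynomial ℝ, p ≠ 0 → ∀ a : ℂ, 0 < a.im → (p.map (algebraMap ℝ ℂ)).eval a = 0 →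
      ∃ z : ℂ, 0 < z.im ∧ ((p.map (algebraMap ℝ ℂ)).eval z *
        (starRingEnd ℂ) ((Polynomial.derivative (p.map (algebraMap ℝ ℂ))).eval z)).im < 0 := by
  intro p hp a ha hroot
  have hP0 : p.map (algebraMap ℝ ℂ) ≠ 0 :=
    (Polynomial.map_ne_zero_iff (algebraMap ℝ ℂ).injective).2 hp
  obtain ⟨r, hfac, hndvd⟩ :=
    (p.map (algebraMap ℝ ℂ)).exists_eq_pow_rootMultiplicity_mul_and_not_dvd hP0 a
  have hm : 0 < (p.map (algebraMap ℝ ℂ)).rootMultiplicity a :=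
    (Polynomial.rootMultiplicity_pos hP0).2 hroot
  have hra : r.eval a ≠ 0 := fun h => hndvd (Polynomial.dvd_iff_isRoot.2 h)
  obtain ⟨k, hk⟩ : ∃ k, (p.map (algebraMap ℝ ℂ)).rootMultiplicity a = k + 1 :=
    ⟨(p.map (algebraMap ℝ ℂ)).rootMultiplicity a - 1, by omega⟩
  rw [hk] at hfac
  rw [hfac]
  exact exists_im_mul_conj_derivative_neg r ha hra k

end Summit.RiemannHypothesis.RiemannHypothesis.Theorems.Splittings.PolyDoorLocalSign
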